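import Mathlib
import Literature.NumberTheory.LFunctions.WeilMarkovQuadratic
import Summits.RiemannHypothesis.RiemannHypothesis.Theorems.WeilFormatCPrimeFormShiftBoundN
import Summits.RiemannHypothesis.RiemannHypothesis.Theorems.WeilFormatCPrimeFormJoint
import Summits.RiemannHypothesis.RiemannHypothesis.Theorems.WeilFarFloorGrowth
import Summits.RiemannHypothesis.RiemannHypothesis.Theorems.WeilFarFloorOrder
import HarnessLib

/-!
# The far-coercivity FLOOR of the Weil window ladder and its identified law (statement file; conjecture row)

Helper file (`--supports stmt-RiemannHypothesis-0098`, lead-track anchor: Weil-positivity window ladder, format C far bound), RH-free.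
Seat rh-explicit-weil-1 gen7 (memo `run/shared/lean/pub/rh-explicit/rh-explicit-weil-1/FORMAT-K3.md` §8.6; data
`run/shared/lean/pub/rh-explicit/rh-explicit-weil-1/floor/`).

THE OBJECT.  Every format-C / C∞ door of the ladder needs a FAR constant `A(a)` with
`Σ_{log n < 2a} 2Λ(n)/√n ∫ f(x − log n) f(x) dx ≤ A · ∫ f²` for all real window functions `f` on `[−a, a]` (hypothesis `hPA`;
route K3 certifies such `A` by torus-SOS certificates).  No certificate can beat the FLOOR
`λ_max(a) = sup_f Q_a(f)/∫f²` (`farCoercivityFloor`), and the far-weight wall of the door is `N₀ = 2a·e^{A}`.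

THE LAW (identified, not fitted; sealed prediction `PREREG-FLOOR-LAW.md` sha256 `2fd21008…`, blind-confirmed 6/6 at
`a = 2.25, 2.5, 2.75, 3.0, 3.5, 4.0` to `|ε| ≤ 0.015` by Galerkin computations, kit jobs j203664 / j203952):
`λ_max(a) = L(a) − 2γ_E + ε(a)`, where `L(a) = 1/(κ² − 1/4)`, `κ·tanh(κa) = 1/2` is the top eigenvalue of the PNT kernel
`e^{|x−y|/2}` on `[−a, a]` (`L(a) = e^a + 2a − 1 + O(a² e^{−a})`), `γ_E` is the Euler–Mascheroni constant (MERTENS: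
`Σ_{n ≤ x} Λ(n)/n = log x − γ_E + o(1)`, entering through the boundary-concentrated eigenfunction's autocorrelation `e^{−u/2}`),
and `ε` is a bounded oscillation driven by the low zeros of `ζ` (the two boundary layers couple through the prime powers
`n ≈ e^{2a}`).  This file only DEFINES the floor, the PNT quantities and the discrepancy predicate `FarFloorDiscrepancyLe C a₀`
(STRUCTURE.md's conjecture C-XIII = `∃ C, FarFloorDiscrepancyLe C 1`; nothing conjectural is asserted here) and proves the elementary transfer `farCoercivityFloor a ≤ A` from any uniform shift bound (so every landed K3 row is a certified
upper bound of the floor).  Standard axioms only.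
-/

set_option linter.dupNamespace false
set_option autoImplicit false

noncomputable section

open MeasureTheory Set Finset
open scoped Real BigOperators ArithmeticFunction.vonMangoldt

namespace Summit.RiemannHypothesis.RiemannHypothesis.Theorems.WeilFormatC

open Literature.NumberTheory.LFunctions

/-- The prime-shift form of the window `[−a, a]`: `Q_a(f) = Σ_{log n < 2a} 2·(Λ(n)/√n) · ∫ f(x − log n) f(x) dx`. [folklore] -/
def primeShiftForm (a : ℝ) (f : ℝ → ℝ) : ℝ :=
  ∑ n ∈ weilPrimeIndex a, 2 * ((Λ n : ℝ) / Real.sqrt n) * ∫ x, f (x - Real.log n) * f x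

/-- The set of Rayleigh quotients `Q_a(f)/∫f²` over real measurable bounded `f` vanishing off `[−a, a]` with `∫ f² > 0`. -/
def primeShiftQuotients (a : ℝ) : Set ℝ :=
  {q | ∃ (f : ℝ → ℝ) (C : ℝ), Measurable f ∧ (∀ x, |f x| ≤ C) ∧ (∀ x, x ∉ Icc (-a) a → f x = 0) ∧
    0 < ∫ x, f x ^ 2 ∧ q = primeShiftForm a f / ∫ x, f x ^ 2}

/-- **The far-coercivity floor** `λ_max(a) = sup_f Q_a(f)/∫f²` — no window-uniform far constant `hPA` lies below it. [folklore] -/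
def farCoercivityFloor (a : ℝ) : ℝ := sSup (primeShiftQuotients a)

/-- The decay rate `κ(a)` of the top eigenfunction `cosh(κx)` of the PNT kernel `e^{|x−y|/2}` on `[−a, a]`: the least
`κ > 1/2` with `κ·tanh(κa) ≥ 1/2` (for `a > 0` the unique root of `κ·tanh(κa) = 1/2`). [folklore] -/
def pntKappa (a : ℝ) : ℝ := sInf {κ : ℝ | 1 / 2 < κ ∧ 1 / 2 ≤ κ * Real.tanh (κ * a)}

/-- The top eigenvalue `L(a) = 1/(κ(a)² − 1/4)` of the PNT kernel `e^{|x−y|/2}` on `L²[−a, a]`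
(`= e^a + 2a − 1 + O(a² e^{−a})`). [folklore] -/
def pntFloor (a : ℝ) : ℝ := 1 / (pntKappa a ^ 2 - 1 / 4)

/-- The DISCREPANCY PREDICATE of the far-coercivity floor law: from `a₀` on, the floor stays within `C` of the PNT kernel
eigenvalue lowered by the Mertens constant, `|λ_max(a) − (L(a) − 2γ_E)| ≤ C` for all `a ≥ a₀`.  STRUCTURE.md conjecture C-XIII
(rh-explicit-weil-1 gen7; sealed `PREREG-FLOOR-LAW.md`, blind 6/6) reads `∃ C, FarFloorDiscrepancyLe C 1`, its sharp observed form
`FarFloorDiscrepancyLe (1/20) (9/4)` (Galerkin residuals `+0.012, −0.004, −0.013, −0.012, −0.015, +0.002` at `a = 2.25 … 4`);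
neither is asserted here. [folklore] -/
def FarFloorDiscrepancyLe (C a₀ : ℝ) : Prop :=
  ∀ a : ℝ, a₀ ≤ a → |farCoercivityFloor a - (pntFloor a - 2 * Real.eulerMascheroniConstant)| ≤ C

/-! ### The elementary transfer: a uniform shift bound is an upper bound of the floor -/

/-- The quotient set is nonempty for `a > 0` (the indicator of the window has `∫ f² = 2a > 0`). -/
theorem primeShiftQuotients_nonempty {a : ℝ} (ha : 0 < a) : (primeShiftQuotients a).Nonempty := by
  set f : ℝ → ℝ := (Icc (-a) a).indicator fun _ ↦ (1 : ℝ) with hf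
  have hmeas : Measurable f := measurable_const.indicator measurableSet_Icc
  have hbd : ∀ x, |f x| ≤ 1 := by
    intro x; simp only [hf, Set.indicator_apply]; split_ifs <;> simp
  have hsupp : ∀ x, x ∉ Icc (-a) a → f x = 0 := fun x hx ↦ by simp [hf, Set.indicator_of_notMem hx]
  have hsq : ∀ x, f x ^ 2 = (Icc (-a) a).indicator (fun _ ↦ (1 : ℝ)) x := by
    intro x; simp only [hf, Set.indicator_apply]; split_ifs <;> simp
  have hint : ∫ x, f x ^ 2 = 2 * a := by
    simp_rw [hsq]
    rw [integral_indicator measurableSet_Icc, setIntegral_const, Real.volume_real_Icc_of_le (by linarith)]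
    simp; ring
  refine ⟨primeShiftForm a f / ∫ x, f x ^ 2, f, 1, hmeas, hbd, hsupp, ?_, rfl⟩
  rw [hint]; linarith

/-- **Every uniform shift bound dominates the floor**: if `Q_a(f) ≤ A·∫f²` for all real measurable bounded `f` vanishing off
`[−a, a]` (`a > 0`), then `λ_max(a) ≤ A`.  (So each landed route-K3 row `…cells…`/`…kcells…` certifies `λ_max ≤ A`.) -/
theorem farCoercivityFloor_le_of_shiftBound {a A : ℝ} (ha : 0 < a)
    (hJ : ∀ (f : ℝ → ℝ) (C : ℝ), Measurable f → (∀ x, |f x| ≤ C) → (∀ x, x ∉ Icc (-a) a → f x = 0) →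
      primeShiftForm a f ≤ A * ∫ x, f x ^ 2) :
    farCoercivityFloor a ≤ A := by
  refine csSup_le (primeShiftQuotients_nonempty ha) ?_
  rintro q ⟨f, C, hm, hC, hs, hpos, rfl⟩
  rw [div_le_iff₀ hpos]
  exact hJ f C hm hC hs

end Summit.RiemannHypothesis.RiemannHypothesis.Theorems.WeilFormatC

/-! ## Appendix (rh-explicit-weil-1 gen8, 2026-08-24): the floor is the LEAST uniform shift bound, is monotone, and has exponential order

With the range form of the prime-shift form (`WeilFormatCPrimeFormShiftBoundN`), translation invariance
(`WeilFarFloorOrder.integral_shift_mul_le_integral_sq`) and the growth / trivial-constant theorems (`WeilFarFloorGrowth`,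
`WeilFarFloorOrder`): the quotient set is bounded, so `Q_a(f) ≤ λ_max(a)·∫f²` for every admissible `f`
(`primeShiftForm_le_floor_mul`, range form `shiftBound_range_floor`); `λ_max` is nondecreasing in `a`; and
`((7/5)e^a − 12a + 11)/(2a) ≤ λ_max(a)` (`a ≥ 3`), `λ_max(a) ≤ 38(e^a + 1)` (`a > 0`).  The numeric window brackets
(`1838/1000 ≤ λ_max(1) ≤ 2027/1000`, …) are staged in `WeilFarCoercivityFloorBrackets` / `…Table` behind the
`WeilFarFloorLowerBounds` olean. -/

namespace Summit.RiemannHypothesis.RiemannHypothesis.Theorems.WeilFormatC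

open Literature.NumberTheory.LFunctions

variable {a : ℝ}

/-! ### The quotient set is bounded: the floor is the least shift bound -/

/-- **Trivial far constant**: `Q_a(f) ≤ (Σ_{log n < 2a} 2Λ(n)/√n) · ∫ f²` for every admissible `f`. -/
theorem primeShiftForm_le_weightSum_mul {f : ℝ → ℝ} (hf : Measurable f) {C : ℝ} (hC : ∀ x, |f x| ≤ C)
    (hsupp : ∀ x, x ∉ Icc (-a) a → f x = 0) :
    primeShiftForm a f ≤ (∑ n ∈ weilPrimeIndex a, 2 * ((Λ n : ℝ) / Real.sqrt n)) * ∫ x, f x ^ 2 := by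
  unfold primeShiftForm
  rw [Finset.sum_mul]
  refine Finset.sum_le_sum fun n _ ↦ ?_
  have hw : 0 ≤ 2 * ((Λ n : ℝ) / Real.sqrt n) :=
    mul_nonneg (by norm_num) (div_nonneg ArithmeticFunction.vonMangoldt_nonneg (Real.sqrt_nonneg _))
  exact mul_le_mul_of_nonneg_left (FloorGrowth.integral_shift_mul_le_integral_sq hf hC hsupp _) hw

/-- The quotient set of the floor is bounded above (by the trivial far constant). -/
theorem primeShiftQuotients_bddAbove (a : ℝ) : BddAbove (primeShiftQuotients a) := by
  refine ⟨∑ n ∈ weilPrimeIndex a, 2 * ((Λ n : ℝ) / Real.sqrt n), ?_⟩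
  rintro q ⟨f, C, hm, hC, hs, hpos, rfl⟩
  rw [div_le_iff₀ hpos]
  exact primeShiftForm_le_weightSum_mul hm hC hs

/-- **The floor is itself a uniform shift bound** (the least one): `Q_a(f) ≤ λ_max(a) · ∫ f²` for every real measurable
bounded `f` vanishing off `[−a, a]`. -/
theorem primeShiftForm_le_floor_mul {f : ℝ → ℝ} (hf : Measurable f) {C : ℝ} (hC : ∀ x, |f x| ≤ C)
    (hsupp : ∀ x, x ∉ Icc (-a) a → f x = 0) :
    primeShiftForm a f ≤ farCoercivityFloor a * ∫ x, f x ^ 2 := by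
  have h0 : 0 ≤ ∫ x, f x ^ 2 := integral_nonneg fun x ↦ sq_nonneg _
  rcases h0.eq_or_lt with hz | hpos
  · have h2 : Integrable (fun x ↦ f x ^ 2) :=
      (integrable_shift_mul_shift hf hC hsupp 0 0).congr
        (Filter.Eventually.of_forall fun x ↦ by simp only [sub_zero, pow_two])
    have hae : (fun x ↦ f x ^ 2) =ᵐ[volume] 0 :=
      (integral_eq_zero_iff_of_nonneg (fun x ↦ sq_nonneg (f x)) h2).1 hz.symm
    have hf0 : f =ᵐ[volume] 0 := hae.mono fun x hx ↦ by simpa using hx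
    have hQ : primeShiftForm a f = 0 := by
      refine Finset.sum_eq_zero fun n _ ↦ ?_
      rw [integral_eq_zero_of_ae (hf0.mono fun x hx ↦ by simp [hx]), mul_zero]
    rw [hQ, ← hz, mul_zero]
  · have hmem : primeShiftForm a f / ∫ x, f x ^ 2 ∈ primeShiftQuotients a := ⟨f, C, hf, hC, hsupp, hpos, rfl⟩
    have := le_csSup (primeShiftQuotients_bddAbove a) hmem
    rwa [div_le_iff₀ hpos] at this

/-- The prime-shift form in range form: `Q_a(f) = Σ_{n<N} 2Λ(n)/√n ∫ f(x − log n) f(x)` whenever `e^{2a} ≤ N`. -/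
theorem primeShiftForm_eq_sum_range {N : ℕ} (hN : Real.exp (2 * a) ≤ N) {f : ℝ → ℝ}
    (hsupp : ∀ x, x ∉ Icc (-a) a → f x = 0) :
    primeShiftForm a f = ∑ n ∈ Finset.range N, 2 * ((Λ n : ℝ) / Real.sqrt n) * (∫ x, f (x - Real.log n) * f x) :=
  sum_weilPrimeIndex_eq_sum_range_of_exp_le hN _ fun k hk ↦ by
    rw [integral_shift_mul_eq_zero_of_le hsupp hk, mul_zero]

/-- The floor in range form: `Σ_{n<N} 2Λ(n)/√n ∫ f(x − log n) f(x) ≤ λ_max(a)·∫f²` whenever `e^{2a} ≤ N`. -/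
theorem shiftBound_range_floor {N : ℕ} (hN : Real.exp (2 * a) ≤ N) (f : ℝ → ℝ) (C : ℝ)
    (hf : Measurable f) (hC : ∀ x, |f x| ≤ C) (hsupp : ∀ x, x ∉ Icc (-a) a → f x = 0) :
    ∑ n ∈ Finset.range N, 2 * ((Λ n : ℝ) / Real.sqrt n) * (∫ x, f (x - Real.log n) * f x)
      ≤ farCoercivityFloor a * ∫ x, f x ^ 2 := by
  rw [← primeShiftForm_eq_sum_range hN hsupp]
  exact primeShiftForm_le_floor_mul hf hC hsupp

/-- From a range-form uniform shift bound to an upper bound of the floor. -/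
theorem farCoercivityFloor_le_of_rangeBound (ha : 0 < a) {N : ℕ} (hN : Real.exp (2 * a) ≤ N) {A : ℝ}
    (hJ : ∀ (f : ℝ → ℝ) (C : ℝ), Measurable f → (∀ x, |f x| ≤ C) → (∀ x, x ∉ Icc (-a) a → f x = 0) →
      ∑ n ∈ Finset.range N, 2 * ((Λ n : ℝ) / Real.sqrt n) * (∫ x, f (x - Real.log n) * f x) ≤ A * ∫ x, f x ^ 2) :
    farCoercivityFloor a ≤ A :=
  farCoercivityFloor_le_of_shiftBound ha fun f C hf hC hsupp ↦ by
    rw [primeShiftForm_eq_sum_range hN hsupp]; exact hJ f C hf hC hsupp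

/-! ### Monotonicity of the floor in the window -/

/-- The prime-shift form of a function vanishing off `[−a, a]` does not change when the window index grows. -/
theorem primeShiftForm_eq_of_le {a a' : ℝ} (haa : a ≤ a') {f : ℝ → ℝ} (hsupp : ∀ x, x ∉ Icc (-a) a → f x = 0) :
    primeShiftForm a f = primeShiftForm a' f := by
  unfold primeShiftForm
  refine Finset.sum_subset (fun n hn ↦ mem_weilPrimeIndex.2 ((mem_weilPrimeIndex.1 hn).trans_le (by linarith)))
    fun n _ hn ↦ ?_
  have h2a : 2 * a ≤ Real.log n := by
    by_contra hlt
    exact hn (mem_weilPrimeIndex.2 (lt_of_not_ge hlt))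
  rw [integral_shift_mul_eq_zero_of_le hsupp h2a, mul_zero]

/-- **The floor is nondecreasing in `a`** (a test function of the smaller window is one of the larger). -/
theorem farCoercivityFloor_mono {a a' : ℝ} (ha : 0 < a) (haa : a ≤ a') : farCoercivityFloor a ≤ farCoercivityFloor a' := by
  refine csSup_le (primeShiftQuotients_nonempty ha) ?_
  rintro q ⟨f, C, hm, hC, hs, hpos, rfl⟩
  have hs' : ∀ x, x ∉ Icc (-a') a' → f x = 0 :=
    fun x hx ↦ hs x fun hx' ↦ hx ⟨by linarith [hx'.1], by linarith [hx'.2]⟩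
  rw [primeShiftForm_eq_of_le haa hs]
  exact le_csSup (primeShiftQuotients_bddAbove a') ⟨f, C, hm, hC, hs', hpos, rfl⟩

/-- **The floor grows exponentially** (window-uniform, from `FloorGrowth.far_constant_growth`): for every `a ≥ 3`,
`((7/5)·e^a − 12a + 11)/(2a) ≤ λ_max(a)`. -/
theorem farCoercivityFloor_ge_growth {a : ℝ} (ha : 3 ≤ a) :
    ((7 / 5) * Real.exp a - 12 * a + 11) / (2 * a) ≤ farCoercivityFloor a := by
  have h := FloorGrowth.far_constant_growth ha (N := ⌈Real.exp (2 * a)⌉₊) (Nat.le_ceil _)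
    (shiftBound_range_floor (Nat.le_ceil _))
  rw [div_le_iff₀ (by linarith)]
  linarith

/-- **A far constant of size `38(e^a + 1)` always exists** (`FloorGrowth.shiftBound_range_trivial`), so `λ_max(a) ≤ 38(e^a + 1)`:
with `farCoercivityFloor_ge_growth` the floor is of exact exponential order `e^a` up to a factor `a`. -/
theorem farCoercivityFloor_le_trivial (ha : 0 < a) : farCoercivityFloor a ≤ 38 * (Real.exp a + 1) :=
  farCoercivityFloor_le_of_rangeBound ha (Nat.le_ceil _) fun _ _ hf hC hsupp ↦
    FloorGrowth.shiftBound_range_trivial hf hC hsupp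

end Summit.RiemannHypothesis.RiemannHypothesis.Theorems.WeilFormatC
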